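import Summits.Ventures.PercRepro.StarGadgetGraphCert

/-!
# Möbius inversion on the Boolean lattice (generic, module 6)

The certificate of `sum_weight_eq_of_cert` derived rather than supplied: for a weight `W` on the
Boolean vectors `Fin k → Bool`, the coefficients
`moebius W U = ∑ t, [zeros t ⊆ U] · (-1)^{|U \ zeros t|} · W t`
satisfy `∑_{U ⊆ zeros t} moebius W U = W t` (`sum_moebius_powerset_zeros`), so the sum of `W` over
the fact vectors of the configurations satisfying `P` is `∑ U, moebius W U · #{ω | P ω ∧ ∀ i ∈ U,
¬ fact i ω}` (`sum_weight_eq_moebius`) — with no per-instance certificate.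
-/

namespace PercRepro.CatGraph

open Finset

/-- `∑_{A ⊆ U ⊆ Z} (-1)^{|U \ A|} = [A = Z]` (for `A ⊆ Z`). -/
theorem sum_neg_one_pow_sdiff_card {α : Type*} [DecidableEq α] (A Z : Finset α) (hAZ : A ⊆ Z) :
    ∑ U ∈ Z.powerset.filter (fun U => A ⊆ U), (-1 : ℤ) ^ (U \ A).card =
      if A = Z then 1 else 0 := by
  have hbij : ∑ U ∈ Z.powerset.filter (fun U => A ⊆ U), (-1 : ℤ) ^ (U \ A).card =
      ∑ V ∈ (Z \ A).powerset, (-1 : ℤ) ^ V.card := by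
    refine Finset.sum_nbij' (fun U => U \ A) (fun V => V ∪ A) ?_ ?_ ?_ ?_ ?_
    · intro U hU
      simp only [mem_filter, mem_powerset] at hU ⊢
      exact Finset.sdiff_subset_sdiff hU.1 le_rfl
    · intro V hV
      simp only [mem_filter, mem_powerset] at hV ⊢
      exact ⟨Finset.union_subset (hV.trans Finset.sdiff_subset) hAZ, Finset.subset_union_right⟩
    · intro U hU
      simp only [mem_filter, mem_powerset] at hU
      exact Finset.sdiff_union_of_subset hU.2
    · intro V hV
      simp only [mem_powerset] at hV
      exact Finset.union_sdiff_cancel_right (Finset.disjoint_of_subset_left hV sdiff_disjoint)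
    · intro U _
      rfl
  rw [hbij, Finset.sum_powerset_neg_one_pow_card]
  by_cases h : A = Z
  · subst h
    simp
  · have h' : ¬ Z \ A = ∅ := by
      rw [Finset.sdiff_eq_empty_iff_subset]
      exact fun hZA => h (Finset.Subset.antisymm hAZ hZA)
    simp [h, h']

/-- The zero set determines the vector. -/
theorem zeros_injective {k : ℕ} {t t' : Fin k → Bool} (h : zeros t = zeros t') : t = t' := by
  funext i
  have hi := congrArg (fun s => i ∈ s) h
  simp only [zeros, mem_filter, mem_univ, true_and, eq_iff_iff] at hi
  revert hi
  cases t i <;> cases t' i <;> simp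

/-- **The Möbius coefficients** of a weight on the Boolean lattice. -/
def moebius {k : ℕ} (W : (Fin k → Bool) → ℤ) (U : Finset (Fin k)) : ℤ :=
  ∑ t : Fin k → Bool, if zeros t ⊆ U then (-1) ^ (U \ zeros t).card * W t else 0

/-- **Möbius inversion**: the coefficients reproduce the weight on every vector. -/
theorem sum_moebius_powerset_zeros {k : ℕ} (W : (Fin k → Bool) → ℤ) (t : Fin k → Bool) :
    ∑ U ∈ (zeros t).powerset, moebius W U = W t := by
  unfold moebius
  rw [Finset.sum_comm]
  have key : ∀ t' : Fin k → Bool,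
      (∑ U ∈ (zeros t).powerset,
        if zeros t' ⊆ U then (-1 : ℤ) ^ (U \ zeros t').card * W t' else 0) =
        if t' = t then W t else 0 := by
    intro t'
    rw [← Finset.sum_filter, ← Finset.sum_mul]
    by_cases h : zeros t' ⊆ zeros t
    · rw [sum_neg_one_pow_sdiff_card _ _ h]
      by_cases h' : zeros t' = zeros t
      · have := zeros_injective h'
        subst this
        simp
      · rw [if_neg h', zero_mul, if_neg (fun e : t' = t => h' (congrArg zeros e))]
    · have h1 : (zeros t).powerset.filter (fun U => zeros t' ⊆ U) = ∅ := by
        rw [Finset.filter_eq_empty_iff]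
        intro U hU hU'
        exact h (hU'.trans (Finset.mem_powerset.1 hU))
      rw [h1, Finset.sum_empty, zero_mul, if_neg (fun e : t' = t => h (by rw [congrArg zeros e]))]
  simp only [key]
  simp

/-- The Möbius coefficients as a certificate list. -/
noncomputable def moebiusList {k : ℕ} (W : (Fin k → Bool) → ℤ) : List (ℤ × Finset (Fin k)) :=
  (univ : Finset (Finset (Fin k))).toList.map fun U => (moebius W U, U)

/-- The Möbius list satisfies the certificate of `sum_weight_eq_of_cert`. -/
theorem moebiusList_cert {k : ℕ} (W : (Fin k → Bool) → ℤ) (t : Fin k → Bool) :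
    ((moebiusList W).map fun mU => if mU.2 ⊆ zeros t then mU.1 else 0).sum = W t := by
  unfold moebiusList
  rw [List.map_map, Finset.sum_map_toList]
  simp only [Function.comp]
  rw [← Finset.sum_filter]
  have : (univ : Finset (Finset (Fin k))).filter (fun U => U ⊆ zeros t) = (zeros t).powerset := by
    ext U
    simp [Finset.mem_powerset]
  rw [this]
  exact sum_moebius_powerset_zeros W t

/-- A signed combination over the Möbius list is the sum over all subsets. -/
theorem sum_moebiusList {k : ℕ} (W : (Fin k → Bool) → ℤ) (N : Finset (Fin k) → ℤ) :
    ((moebiusList W).map fun mU => mU.1 * N mU.2).sum = ∑ U, moebius W U * N U := by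
  unfold moebiusList
  rw [List.map_map, Finset.sum_map_toList]
  rfl

/-- **Counting by Möbius inversion**: the sum of a weight of the fact vector over the configurations
satisfying `P` is the Möbius combination of the counts `#{ω | P ω ∧ ∀ i ∈ U, ¬ fact i ω}`. -/
theorem sum_weight_eq_moebius {Ω : Type*} [Fintype Ω] {k : ℕ}
    (P : Ω → Prop) [DecidablePred P] (fact : Fin k → Ω → Prop) [∀ i, DecidablePred (fact i)]
    (W : (Fin k → Bool) → ℤ) :
    ∑ ω ∈ univ.filter P, W (fun i => decide (fact i ω)) =
      ∑ U, moebius W U * ((univ.filter fun ω => P ω ∧ ∀ i ∈ U, ¬ fact i ω).card : ℤ) := by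
  rw [sum_weight_eq_of_cert P fact W (moebiusList W) (moebiusList_cert W)]
  exact sum_moebiusList W fun U => ((univ.filter fun ω => P ω ∧ ∀ i ∈ U, ¬ fact i ω).card : ℤ)

end PercRepro.CatGraph
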